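import Summits.ResolutionOfSingularities.ResolutionOfSingularities.Theorems.MarkedTransferCampaignW21ChainSchemeModel
import Literature.AlgebraicGeometry.Resolution.SmoothOfRegularPerfectField
import HarnessLib

/-!
# [OURS · L1 W2.1] The two-level H♭ chain AS A SCHEME-LEVEL INSTANCE of row 019's `LLChain` on `𝔸³_{𝔽_p}`, and the
# refutation of the typed `S16Proof.Lem16_7` / `S16Proof.U85L8` at that instance (kernel K-R91-1, part 2 of 2; the data,
# orders and points are in `…ChainSchemeModel.lean`)

Rung L (rescue) of cell res-hironaka, RESCUE-SEED row L-G2, slot W2.1 (USE half), seat res-L1-s21-pv-1 (gen 3); kernel request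
K-R91-1 of the adjudication (res-adj-1 GAP-AMEND R91 2026-08-27T06:34:11Z, res-plan-2 BOOKED 06:35:14Z, director-resolution CLASS
RULING R91 (3b) 06:40:10Z). The manuscript under adjudication is H. Hironaka, *Resolution of singularities in positive
characteristics*, 2017-03-23 (lit key `paper:url-3343fd9e678b`) [claim: Hironaka2017, status: under-review]; NOTHING of it is
asserted or denied here. This file is about OUR data and about two TYPED candidate statements (row 095b,
`Literature/AlgebraicGeometry/Hironaka2017/S16Proof/R095bLem167.lean`): it shows that those typed readings fail at an instance
whose knock-outs ARE the values of the printed H♭ recipe (Def. 9.7 / Rem. 9.9, Case (I)) on a class-safe datum — unlike the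
tree's earlier countermodel `S16Proof.not_Lem16_7` (`Proofs/S16Proof/Lem16p7Countermodel.lean`, p.a.: `𝔸²_{𝔽₂}`, centre
`D = ∇` of codimension 1, knock-outs `h = (x⁶, x³)` chosen freely in the placeholder slots), which the G4 lead classed as a
placeholder-typing artefact. AI-written; AI review is weaker than expert review.

## The instance (namespace `…CampaignW21.ChainScheme`; every prime `p`; `y = X 0`, `u = X 1`, `v = X 2`)

* Ambient datum (row 001 `AmbientDatum p 𝔽_p`): `Z = Spec 𝔽_p[y,u,v] → Spec 𝔽_p` (`amb`; smooth, irreducible, affine; `𝔽_p`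
  perfect).
* The chain (row 019 `LLChain p 2 ξ (fun _ ↦ univ) univ`, placeholder ℘-slots `univ` as the typing allows), `e = 2`,
  `q = p²`, at the origin `ξ`: `g = (y^{p²} + ε₀, y^p + ε₁, y)`, `y(i) = y`, `ε = (ε₀, ε₁, 0)`, `h = (h₀, h₁)` with
  `ε₀ = y^{p²−1}u^{p²+1}v^{p²} + y^{p²−1}u v^{2p²} + u^{p²}v^{p³+p²+p}` (the series-level `ChainWitness.eps0` of p504005, a
  `MinDegreeTop` datum in Case (I) only — `…ChainWitness.lean` p504843), `h₀ = ε₀ + v^{p³+2p²+p}` = THE H♭ VALUE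
  `∂^{(p²−1,1,0)}ε₀ · ∂^{(0,p²,p²)}ε₀` (`h0_coe_eq_hflat`, from `ChainWitness.hd_prod0`), `ε₁ = h₁ = −v^{(p+1)²}`
  (`H♭(ε₁) = ε₁`, p504843); chain identities `g(0) = g(1)^p + h₀`, `g(1) = g(2)^p + h₁`; `∇ = {y = 0}` (regular); all order
  conditions of Eq. (129) at `ξ` (`ord_ξ ε(i) > q(i)`, `ord_ξ h(i) > q(i)`, `ord_ξ g(0) ≥ p²`, `ord_ξ y = 1`).
* The centre `D = V(y, u)` (`CoordChart.coordCentre`, a line INSIDE `∇ = V(y)`, codimension 2), `ξ ∈ D`: irreducible, smooth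
  over `𝔽_p`, and `D ⊆ Sing(F̌(0)) = {ord g(0) ≥ p²}` since `g(0) ∈ (y,u)^{p²}` — so `D` IS permissible for `F̌(0)`
  (`isPermissibleCentre_F0`); but at the point `(0,0,1) ∈ D` the member `g(1) = y^p − v^{(p+1)²}` is a unit, so
  `D ⊄ Sing(F̌(1)) = {ord g(1) ≥ p}` and `D` is NOT permissible for `F̌(1)` (`not_isPermissibleCentre_F1`); and at the generic
  point `η = (y,u)` of `D`: `ord_D h₀ = 0` while `ord_D ε₀ ≥ p²` (`sectionOrder_h0_η`, `sq_le_sectionOrder_eps0_η`) — the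
  D-adic inequality «ord_D h(i) ≥ ord_D ε(i)» consumed at p.85 L10–L11 (GAP row R91 sub-key (3b)) fails at the value level
  ON THE SCHEME, while its second half «ord_D ε(i) ≥ p^{e−i}» holds.

## Theorems (namespace `…Theorems.CampaignW21`)

* `lem16_7_fails_at p` — for every prime `p`, the hypotheses of the typed `Lem16_7` hold at the instance and its conclusion
  fails at `i = 1`; `not_Lem16_7_hflat : ¬ S16Proof.Lem16_7.{0}`.
* `u85L8_fails_at p` — for every prime `p`, the typed in-proof claims `U85L8` fail at the instance (clause (b) at `i = 0`:
  any chain `C′` with `C′.h = C.h` would need `p² ≤ ord_η ε′(0) ≤ ord_η h₀ = 0`); `not_U85L8_hflat : ¬ S16Proof.U85L8.{0}`.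
Universe: the instance lives in `Type 0` (`𝔽_p = ZMod p`), so the universe-polymorphic decls are refuted at level `0` (cell
practice, as `S16Proof.not_Lem16_7`). What the failure MEANS for the manuscript (whose Lem. 16.7 says «for this LL-chain» after a
modification, and whose `h(i) ∈ ⊞(g(i)) ⊂ ℘(F̌(i))` is a placeholder in the typing) is the adjudicators' business (GAP rows
R91/R08/R48), not claimed here.
-/

noncomputable section

set_option linter.dupNamespace false -- mandated namespace of this single-conjunct summit

namespace Summit.ResolutionOfSingularities.ResolutionOfSingularities.Theorems

namespace CampaignW21

open AlgebraicGeometry CategoryTheory MvPolynomial IsLocalRing TopologicalSpace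
open Literature.AlgebraicGeometry.Resolution Scheme.IdealSheafData
open Literature.AlgebraicGeometry.Hironaka2017.S02Preliminaries
open Literature.AlgebraicGeometry.Hironaka2017.S02Preliminaries.CoordChart
open Literature.AlgebraicGeometry.Hironaka2017.S16Proof
open Literature.AlgebraicGeometry.Hironaka2017.SpecOrders

namespace ChainScheme

variable (p : ℕ) [hp : Fact p.Prime]

/-! ## The chain datum (129) of the instance at the origin -/

/-- the members `g = (g(0), g(1), y)` [folklore] -/
def gA : Fin 3 → A p := ![g0 p, g1 p, X 0]

/-- the knock-outs `h = (h₀, ε₁)` [folklore] -/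
def hA : Fin 2 → A p := ![h0 p, eps1 p]

/-- the remainders `ε = (ε₀, ε₁, 0)` [folklore] -/
def epsA : Fin 3 → A p := ![eps0 p, eps1 p, 0]

/-- The principal ideal sheaf `y·𝒪` is the ideal of the coordinate hyperplane `V(y)`. [folklore] -/
theorem principalIdealSheaf_X0_eq :
    principalIdealSheaf (sec p (X 0)) = vanishingIdeal (coordCentre (k p) (Fin 3) {0}) := by
  rw [vanishingIdeal_coordCentre]
  apply Scheme.IdealSheafData.ext_of_isAffine
  rw [til_ideal_top, ideal_ofIdealTop_top, coordIdeal, Set.image_singleton, Ideal.map_span, Set.image_singleton]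

/-- **`∇ = V(y)` is a regular scheme** (a coordinate hyperplane of `𝔸³`). [folklore] -/
theorem isRegular_subscheme_X0 : Scheme.IsRegular (principalIdealSheaf (sec p (X 0))).subscheme := by
  rw [principalIdealSheaf_X0_eq]
  exact isRegular_coordCentre _

/-- **The LL-chain datum (129) of the instance** (row 019 `LLChain p 2 ξ (fun _ ↦ univ) univ`): `g = (y^{p²}+ε₀, y^p+ε₁, y)`,
`h = (h₀, ε₁)`, `y(i) = y`, `ε = (ε₀, ε₁, 0)`; placeholder ℘-slots `univ`. [folklore] -/
def chainC : LLChain (Z := Z p) p 2 (ξ p) (fun _ => Set.univ) Set.univ where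
  g i := sec p (gA p i)
  h i := sec p (hA p i)
  y _ := sec p (X 0)
  ε i := sec p (epsA p i)
  one_le_e := by norm_num
  ξ_closed := ξ_closed p
  ξ_sing := by
    show ((p ^ 2 : ℕ) : ℕ∞) ≤ sectionOrder (sec p (g0 p)) (ξ p)
    exact le_sectionOrder_of_mem_pow p (ξ p) _ _ (g0_mem_𝔪_pow p)
  chain i := by
    fin_cases i
    · show sec p (g0 p) = sec p (g1 p) ^ p + sec p (h0 p)
      rw [← map_pow, ← map_add, chain0]
    · show sec p (g1 p) = sec p (X 0) ^ p + sec p (eps1 p)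
      rw [← map_pow, ← map_add, g1]
  head_form i := by
    fin_cases i
    · show sec p (g0 p) = sec p (X 0) ^ p ^ 2 + sec p (eps0 p)
      rw [← map_pow, ← map_add, g0]
    · show sec p (g1 p) = sec p (X 0) ^ p ^ 1 + sec p (eps1 p)
      rw [pow_one, ← map_pow, ← map_add, g1]
    · show sec p (X 0) = sec p (X 0) ^ p ^ 0 + sec p 0
      rw [pow_zero, pow_one, map_zero, add_zero]
  ord_ε i := by
    fin_cases i
    · show ((p ^ 2 : ℕ) : ℕ∞) < sectionOrder (sec p (eps0 p)) (ξ p)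
      exact lt_sectionOrder_of_mem_pow_succ p (ξ p) _ _ (eps0_mem_𝔪_pow p)
    · show ((p ^ 1 : ℕ) : ℕ∞) < sectionOrder (sec p (eps1 p)) (ξ p)
      rw [pow_one]
      exact lt_sectionOrder_of_mem_pow_succ p (ξ p) _ _ (eps1_mem_𝔪_pow p)
    · show ((p ^ 0 : ℕ) : ℕ∞) < sectionOrder (sec p 0) (ξ p)
      rw [pow_zero]
      exact lt_sectionOrder_of_mem_pow_succ p (ξ p) 0 1 (zero_mem _)
  head_mem := Set.mem_univ _
  ord_tail := by
    show sectionOrder (sec p (X 0)) (ξ p) = 1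
    exact sectionOrder_X0_ξ p
  h_mem _ := Set.mem_univ _
  ord_h i := by
    fin_cases i
    · show ((p ^ 2 : ℕ) : ℕ∞) < sectionOrder (sec p (h0 p)) (ξ p)
      exact lt_sectionOrder_of_mem_pow_succ p (ξ p) _ _ (h0_mem_𝔪_pow p)
    · show ((p ^ 1 : ℕ) : ℕ∞) < sectionOrder (sec p (eps1 p)) (ξ p)
      rw [pow_one]
      exact lt_sectionOrder_of_mem_pow_succ p (ξ p) _ _ (eps1_mem_𝔪_pow p)
  nabla_regular := isRegular_subscheme_X0 p

/-! ## The hypotheses of Lem. 16.7 hold at the instance … -/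

/-- `D = V(y,u) ⊆ ∇ = V(y)` (the chain coupling «D ⊂ ∇» of p.85 L2). [folklore] -/
theorem D_subset_nabla : (D p : Set (Z p)) ⊆ ((chainC p).nabla : Set (Z p)) := by
  intro x hx
  have hx' := (mem_coordCentre_iff S x).mp hx
  change x ∈ (principalIdealSheaf (sec p (X 0))).support
  rw [principalIdealSheaf_sec, mem_support_shf_iff, Ideal.span_singleton_le_iff_mem]
  exact hx' (X0_mem_P p)

/-- `D ⊆ Sing(F̌(0)) = {ord g(0) ≥ p²}`, since `g(0) ∈ (y,u)^{p²}`. [folklore] -/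
theorem D_subset_sing_F0 : (D p : Set (Z p)) ⊆ ((chainC p).F 0).sing := by
  intro x hx
  have hx' := (mem_coordCentre_iff S x).mp hx
  show ((p ^ (2 - 0) : ℕ) : ℕ∞) ≤ sectionOrder (sec p (g0 p)) x
  exact le_sectionOrder_of_mem_pow p x _ _ (Ideal.pow_right_mono hx' _ (g0_mem_P_pow p))

/-- **`D = V(y,u)` is a SMOOTH irreducible permissible centre for `F̌(0) = (g(0)·𝒪, p²)` over `𝔽_p`** (row 001
`IsPermissibleCentre`: irreducible; the reduced `V(𝓘_D) ≅ 𝔸¹ → Spec 𝔽_p` is smooth — regular of finite type over a perfect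
field; `D ⊆ Sing(F̌(0))`). [folklore] -/
theorem isPermissibleCentre_F0 : ((chainC p).F 0).IsPermissibleCentre (amb p).hom (D p) where
  irreducible := isIrreducible_coordCentre S
  smooth := by
    change Smooth ((vanishingIdeal (D p)).subschemeι ≫ f p)
    haveI : Smooth (f p) := smooth_f p
    haveI : PerfectField (k p) := perfectField_k p
    haveI : LocallyOfFiniteType ((vanishingIdeal (D p)).subschemeι ≫ f p) := inferInstance
    exact smooth_of_isRegular_of_perfectField _ (isRegular_coordCentre S)
  subset_sing := D_subset_sing_F0 p

/-- `D` is also a REGULAR irreducible permissible centre for `F̌(0)` (row 001 `IsRegPermissibleCentre`, the «(or only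
regular)» reading). [folklore] -/
theorem isRegPermissibleCentre_F0 : ((chainC p).F 0).IsRegPermissibleCentre (D p) where
  irreducible := isIrreducible_coordCentre S
  regular := isRegular_coordCentre S
  subset_sing := D_subset_sing_F0 p

/-! ## … and its conclusion fails at `i = 1`; the D-adic inequality of p.85 L10–L11 fails at the generic point of `D` -/

/-- `ord_{(0,0,1)}(g(1)) = 0`: the member `g(1)` is a unit at the point `(0,0,1) ∈ D`. [folklore] -/
theorem sectionOrder_g1_pt : sectionOrder (sec p (g1 p)) (pt p) = 0 :=
  sectionOrder_eq_zero_of_not_mem p (pt p) _ (g1_not_mem_pt p)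

/-- `ord_D(g(1)) = 0` at the generic point of `D`. [folklore] -/
theorem sectionOrder_g1_η : sectionOrder (sec p (g1 p)) (η p) = 0 :=
  sectionOrder_eq_zero_of_not_mem p (η p) _ (g1_not_mem_P p)

/-- **`D` is NOT a permissible centre for `F̌(1) = (g(1)·𝒪, p)`**: `D ⊄ Sing(F̌(1))` at `(0,0,1)`. [folklore] -/
theorem not_isPermissibleCentre_F1 : ¬ ((chainC p).F 1).IsPermissibleCentre (amb p).hom (D p) := by
  intro h
  have h1 := h.subset_sing (pt_mem_D p)
  change ((p ^ (2 - 1) : ℕ) : ℕ∞) ≤ sectionOrder (sec p (g1 p)) (pt p) at h1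
  rw [sectionOrder_g1_pt, pow_one] at h1
  have : (1 : ℕ∞) ≤ (p : ℕ∞) := by exact_mod_cast hp.out.one_lt.le
  exact absurd (this.trans h1) (by decide)

/-- Nor in the «(or only regular)» reading: `D` is not an `IsRegPermissibleCentre` for `F̌(1)`. [folklore] -/
theorem not_isRegPermissibleCentre_F1 : ¬ ((chainC p).F 1).IsRegPermissibleCentre (D p) := by
  intro h
  have h1 := h.subset_sing (pt_mem_D p)
  change ((p ^ (2 - 1) : ℕ) : ℕ∞) ≤ sectionOrder (sec p (g1 p)) (pt p) at h1
  rw [sectionOrder_g1_pt, pow_one] at h1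
  have : (1 : ℕ∞) ≤ (p : ℕ∞) := by exact_mod_cast hp.out.one_lt.le
  exact absurd (this.trans h1) (by decide)

/-- **`ord_D(h₀) = 0`**: the H♭ knock-out `h₀` is a unit at the generic point of `D`. [folklore] -/
theorem sectionOrder_h0_η : sectionOrder (sec p (h0 p)) (η p) = 0 :=
  sectionOrder_eq_zero_of_not_mem p (η p) _ (h0_not_mem_P p)

/-- **`ord_D(ε₀) ≥ p² = q(0)`** at the generic point of `D` (the SECOND inequality of p.85 L10–L11 holds). [folklore] -/
theorem sq_le_sectionOrder_eps0_η : ((p ^ 2 : ℕ) : ℕ∞) ≤ sectionOrder (sec p (eps0 p)) (η p) :=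
  le_sectionOrder_of_mem_pow p (η p) _ _ (eps0_mem_P_pow p)

/-- **The consumed D-adic inequality «ord_D h(0) ≥ ord_D ε(0)» FAILS on the scheme**: `ord_D h₀ = 0 < p² ≤ ord_D ε₀` at the
generic point `η` of `D` (GAP row R91 sub-key (3b), value level, every prime `p`). [folklore] -/
theorem sectionOrder_h0_lt_sectionOrder_eps0_η : sectionOrder (sec p (h0 p)) (η p) < sectionOrder (sec p (eps0 p)) (η p) := by
  rw [sectionOrder_h0_η]
  refine lt_of_lt_of_le ?_ (sq_le_sectionOrder_eps0_η p)
  exact_mod_cast pow_pos hp.out.pos 2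

end ChainScheme

open ChainScheme

/-- **For every prime `p`, the typed Lemma 16.7 (`S16Proof.Lem16_7`, row 095b) FAILS AT THE H♭ TWO-LEVEL CHAIN on `𝔸³_{𝔽_p}`**:
its hypotheses hold (`D = V(y,u) ⊆ ∇ = V(y)`, `ξ ∈ D` closed, `D` permissible for `F̌(0) = (g(0)·𝒪, p²)`) and its conclusion
fails at `i = 1` (`D` not permissible for `F̌(1) = (g(1)·𝒪, p)`: `g(1)` is a unit at `(0,0,1) ∈ D`). [OURS · L1 W2.1 · K-R91-1]
A kernel fact about the typed reading at OUR instance; nothing of the manuscript asserted or denied. [folklore] -/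
theorem lem16_7_fails_at (p : ℕ) [Fact p.Prime] :
    (D p : Set (Z p)) ⊆ ((chainC p).nabla : Set (Z p)) ∧ ξ p ∈ (D p : Set (Z p)) ∧
      ξ p ∈ Literature.AlgebraicGeometry.Hironaka2017.S02Preliminaries.closedPoints (Z p) ∧ ((chainC p).F 0).IsPermissibleCentre (amb p).hom (D p) ∧
      ¬ (∀ i : Fin (2 + 1), 1 ≤ (i : ℕ) → ((chainC p).F i).IsPermissibleCentre (amb p).hom (D p)) :=
  ⟨D_subset_nabla p, ξ_mem_D p, ξ_closed p, isPermissibleCentre_F0 p,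
    fun h => not_isPermissibleCentre_F1 p (h 1 (by norm_num))⟩

/-- **`S16Proof.Lem16_7` (Lemma 16.7 p.85 l.6–7 AS TYPED, row 095b) is false — witnessed by the H♭ two-level chain** (any prime;
here `p = 2`): see `lem16_7_fails_at`. Companion of the tree's `S16Proof.not_Lem16_7` (free placeholder knock-outs, centre
`D = ∇` of codimension 1); here the knock-outs are the printed H♭ values (`ChainScheme.h0_coe_eq_hflat`) and `D ⊂ ∇` has
codimension 2. Level-0 instance of the universe-polymorphic decl. [OURS · L1 W2.1 · K-R91-1] [folklore] -/
theorem not_Lem16_7_hflat : ¬ Literature.AlgebraicGeometry.Hironaka2017.S16Proof.Lem16_7.{0} := by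
  intro h
  haveI : PerfectField (k 2) := perfectField_k 2
  exact not_isPermissibleCentre_F1 2 (h 2 (k 2) (amb 2) 2 (ξ 2) (fun _ => Set.univ) Set.univ (chainC 2) (D 2)
    (D_subset_nabla 2) (ξ_mem_D 2) (ξ_closed 2) (isPermissibleCentre_F0 2) 1 (by norm_num))

/-- **For every prime `p`, the typed in-proof claims of Lemma 16.7 (`S16Proof.U85L8`, p.85 l.8–12, row 095b) FAIL AT THE H♭
TWO-LEVEL CHAIN**: clause (b) «ord_D(h(i)) ≥ ord_D(ε(i)) ≥ p^{e−i}» at `i = 0` would give, for any modified chain `C′` with the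
same knock-outs, `p² ≤ ord_η ε′(0) ≤ ord_η h₀ = 0` at the generic point `η` of `D`. [OURS · L1 W2.1 · K-R91-1] [folklore] -/
theorem u85L8_fails_at (p : ℕ) [hp : Fact p.Prime] :
    ¬ ∃ C' : LLChain (Z := Z p) p 2 (ξ p) (fun _ => Set.univ) Set.univ, C'.g = (chainC p).g ∧ C'.h = (chainC p).h ∧
      ∀ η' : Z p, IsGenericPoint η' (D p : Set (Z p)) →
        (∀ i : Fin (2 + 1), ((p ^ (2 - (i : ℕ)) : ℕ) : ℕ∞) ≤ sectionOrder (C'.y i) η') ∧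
        (∀ i : Fin 2, sectionOrder (C'.ε i.castSucc) η' ≤ sectionOrder (C'.h i) η' ∧
          ((p ^ (2 - (i : ℕ)) : ℕ) : ℕ∞) ≤ sectionOrder (C'.ε i.castSucc) η') ∧
        (∀ i : Fin (2 + 1), ((p ^ (2 - (i : ℕ)) : ℕ) : ℕ∞) ≤ sectionOrder (C'.g i) η') := by
  rintro ⟨C', -, hh, hC'⟩
  obtain ⟨-, hb, -⟩ := hC' (η p) (isGenericPoint_η p)
  obtain ⟨h1, h2⟩ := hb 0
  rw [hh] at h1
  change sectionOrder (C'.ε 0) (η p) ≤ sectionOrder (sec p (h0 p)) (η p) at h1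
  rw [sectionOrder_h0_η] at h1
  have h3 : ((p ^ 2 : ℕ) : ℕ∞) ≤ 0 := h2.trans h1
  have h4 : ((p ^ 2 : ℕ) : ℕ∞) = 0 := le_antisymm h3 bot_le
  exact pow_ne_zero 2 hp.out.ne_zero (by exact_mod_cast h4)

/-- **`S16Proof.U85L8` (the in-proof claims of Lemma 16.7, p.85 l.8–12 AS TYPED, row 095b) is false — witnessed by the H♭
two-level chain** (`p = 2`): see `u85L8_fails_at`. Level-0 instance of the universe-polymorphic decl. [OURS · L1 W2.1 · K-R91-1]
[folklore] -/
theorem not_U85L8_hflat : ¬ Literature.AlgebraicGeometry.Hironaka2017.S16Proof.U85L8.{0} := by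
  intro h
  haveI : PerfectField (k 2) := perfectField_k 2
  exact u85L8_fails_at 2 (h 2 (k 2) (amb 2) 2 (ξ 2) (fun _ => Set.univ) Set.univ (chainC 2) (D 2)
    (D_subset_nabla 2) (ξ_mem_D 2) (ξ_closed 2) (isPermissibleCentre_F0 2))

end CampaignW21

end Summit.ResolutionOfSingularities.ResolutionOfSingularities.Theorems

end
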